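/-
Origin: expansion seat `planner-pub-hodgecm-mc-sanity-1-g3-0`, handover #3 2026-08-19T00:28Z md5 0fe6149fb2f33997f4533e955a83c905 (NEW, 266 l., 20 decls in namespace HodgeCM.Model.Sanity; imports ONLY the installed r32 module HodgeCM.Automorphic.ThetaWedgeSplit + Mathlib.LinearAlgebra.Matrix.Notation + Mathlib.LinearAlgebra.Matrix.GeneralLinearGroup.Defs + Mathlib.Topology.Algebra.Constructions — install any time; rc 0 / 0 warnings / ~6 s; axioms trio 20/20; content S (`HOME/mc/pub-hodgecm-mc-sanity-1-g3/lean/BallFactsDegenerate.lean`, md5 0fe6149f, 266 lines);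
landed by the gen-9 packager (p-g9) in gate run 33 as `HodgeCM/Model/Sanity/BallFactsDegenerate.lean` (verbatim).
-/
/-
Origin: SANITY lane `planner-pub-hodgecm-mc-sanity-1-g3-0` (unit pub-hodgecm-mc-sanity-1-g3, gen 3 of mc-sanity-1,
node SAN-6a), 2026-08-19.  NEW additive leaf under `HodgeCM/Model/Sanity/`; imports the INSTALLED r32 module
`HodgeCM.Automorphic.ThetaWedgeSplit` and three Mathlib files only; nothing imports it.  KERNEL: 0 records, 0
hypotheses minted, no global instances.  Expected `#print axioms`: ⊆ {propext, Classical.choice, Quot.sound}.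
-/
import Summits.HodgeConjecture.HodgeCM.Automorphic.ThetaWedgeSplit
import Mathlib.LinearAlgebra.Matrix.Notation
import Mathlib.LinearAlgebra.Matrix.GeneralLinearGroup.Defs
import Mathlib.Topology.Algebra.Constructions

/-!
# SAN-6a: what the E binders `ball` / `ballFacts` certify on their own — a one-point ball passes

`ThetaModel.BallFacts V c b` (PKG `HodgeCM/Automorphic/ThetaWedgeSplit`) is the ten-field record behind E's
binders 11/12 (`ball`, `ballFacts`; pinned at R6 by mc-period-1-g3's `Model.ballOf` / `Model.ballFactsOf`).  Five
of its fields (`contEv transl evNe wedgeDict saturate`) quantify over the theta sets `T.Theta V c i Γ`, the other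
five (`csmul contJ unitJ trans dense irred`; with `csmul` an instance) do not.  This file records in the kernel,
over an ARBITRARY universe `U`, theta model `T` and context `(V, c)`:

* § 1 `BallFacts` carries NO cocycle / geometry constraint tying `J`, `Pt`, `Δ` to a ball: the ONE-POINT datum
  `pointBallData U V c` (`Pt := PUnit`, `Gr := GL₂(ℂ)` acting trivially, `Δ := univ`, `J g _ := g`, `ev := 0`)
  satisfies the five theta-free fields (`pointBallData_printFacts`); `irred` is the elementary fact that every
  nonzero `v ∈ ℂ²` is moved off its line by a unipotent matrix.
* § 2 If the theta sets of the context are trivial (`T.Theta V c i Γ = {0}` for all `i, Γ` — the value of the R6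
  pin through the bottom input of SAN-5b, and the value an HONEST producer returns if the level placement (J-lvl)
  keeps the theta forms out of `weightForms`, SAN-5b § 3) then for ANY ball datum with `ev Γ 0 = 0` the five
  theta fields hold outright (`ballFacts_of_theta_trivial`), so `T.BallFacts V c b` is EXACTLY the five print
  fields; in particular the one-point datum passes: `ballFacts_pointBallData`, and `T.BallInputs` holds for it in
  every context (`ballInputs_pointBallData`).
* § 3 In the same regime the A6 engine is starved, not fed: `¬ T.Open_supply` and `¬ T.Open_thetaWedge` as soon
  as one good context exists (`not_open_supply_of_theta_trivial`, `not_open_thetaWedge_of_theta_trivial`).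
* § 4 Dually, if a theta set is EVERYTHING (`T.Theta V c i Γ = univ`, the top input of SAN-5b) then `BallFacts`
  makes `ev Γ` detect every nonzero degree-one class and makes every class lift continuous
  (`ev_ne_zero_of_ballFacts_top`, `continuous_ev_of_ballFacts_top`) — constraints on ALL of `H¹`, not on `H^{1,0}`.

VERDICT (MODEL-N += 0; nothing cited): binder 12 `ballFacts` has content only JOINTLY with the `Theta` producer and
the specific datum `ballOf` (which fixes `Pt = 𝔹²`, `Gr = U(2,1)`, `ev = classLift`); the record itself is
satisfiable by a point.  Referees should therefore read `ballFactsOf`'s remaining hypotheses `hsub hsat hcov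
htransl` against the ACTUAL theta sets, and note that with trivial theta sets all four hold vacuously while
`Open_supply` fails (§ 3) — the failure then surfaces in `classPacks`, not in `ballFacts`.
-/

set_option autoImplicit false

noncomputable section

open Matrix Function Set
open HodgeCM.LineField (wedge2)

namespace HodgeCM
namespace Model
namespace Sanity

open HodgeCM.Universe HodgeCM.Universe.ThetaModel

variable (U : Universe)

/-! ## § 1. The one-point ball datum and its five print facts -/

section Point

variable {L : CMField} {ι₁ : L →+* ℂ} (V : HermSpace3 L ι₁) (c : SeesawCtx L)

/-- **The one-point ball datum**: `Pt := PUnit`, `Gr := GL₂(ℂ)` acting trivially, `Δ := univ`, `J g _ := g`,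
`ev := 0`. -/
def pointBallData : U.BallData V c where
  Pt := PUnit.{1}
  Gr := GL (Fin 2) ℂ
  act := { smul := fun _ x => x, one_smul := fun _ => rfl, mul_smul := fun _ _ _ => rfl }
  Δ := univ
  J := fun g _ => (g : Matrix (Fin 2) (Fin 2) ℂ)
  ev := fun _ _ _ => 0

/-- (Ported verbatim from the HodgeCMPerL package; no docstring in the source.) -/
@[simp] theorem pointBallData_ev (Γ : Level V) (ω : U.CohC (U.pms L ι₁ V Γ) 1) :
    (pointBallData U V c).ev Γ ω = 0 := rfl

/-- The lower unipotent matrix `[[1,0],[1,1]]` as an element of `GL₂(ℂ)`. -/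
def lowerUnipotent : GL (Fin 2) ℂ :=
  GeneralLinearGroup.mkOfDetNeZero !![(1 : ℂ), 0; 1, 1] (by simp [Matrix.det_fin_two_of])

/-- The upper unipotent matrix `[[1,1],[0,1]]` as an element of `GL₂(ℂ)`. -/
def upperUnipotent : GL (Fin 2) ℂ :=
  GeneralLinearGroup.mkOfDetNeZero !![(1 : ℂ), 1; 0, 1] (by simp [Matrix.det_fin_two_of])

/-- (Ported verbatim from the HodgeCMPerL package; no docstring in the source.) -/
@[simp] theorem coe_lowerUnipotent : (lowerUnipotent : Matrix (Fin 2) (Fin 2) ℂ) = !![(1 : ℂ), 0; 1, 1] := rfl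

/-- (Ported verbatim from the HodgeCMPerL package; no docstring in the source.) -/
@[simp] theorem coe_upperUnipotent : (upperUnipotent : Matrix (Fin 2) (Fin 2) ℂ) = !![(1 : ℂ), 1; 0, 1] := rfl

/-- (Ported verbatim from the HodgeCMPerL package; no docstring in the source.) -/
theorem wedge2_lowerUnipotent_mulVec (v : Fin 2 → ℂ) :
    wedge2 ((lowerUnipotent : Matrix (Fin 2) (Fin 2) ℂ) *ᵥ v) v = -(v 0 * v 0) := by
  rw [coe_lowerUnipotent]
  simp [wedge2, Matrix.mulVec, dotProduct, Fin.sum_univ_two]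
  ring

/-- (Ported verbatim from the HodgeCMPerL package; no docstring in the source.) -/
theorem wedge2_upperUnipotent_mulVec (v : Fin 2 → ℂ) :
    wedge2 ((upperUnipotent : Matrix (Fin 2) (Fin 2) ℂ) *ᵥ v) v = v 1 * v 1 := by
  rw [coe_upperUnipotent]
  simp [wedge2, Matrix.mulVec, dotProduct, Fin.sum_univ_two]
  ring

/-- **Every nonzero `v ∈ ℂ²` is moved off its line by an invertible matrix** (a unipotent one). -/
theorem exists_gl_wedge2_mulVec_ne_zero (v : Fin 2 → ℂ) (hv : v ≠ 0) :
    ∃ g : GL (Fin 2) ℂ, wedge2 ((g : Matrix (Fin 2) (Fin 2) ℂ) *ᵥ v) v ≠ 0 := by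
  by_cases h0 : v 0 = 0
  · have h1 : v 1 ≠ 0 := by
      intro h1
      apply hv
      funext i
      fin_cases i
      · exact h0
      · exact h1
    exact ⟨upperUnipotent, by rw [wedge2_upperUnipotent_mulVec]; exact mul_ne_zero h1 h1⟩
  · exact ⟨lowerUnipotent, by rw [wedge2_lowerUnipotent_mulVec, neg_ne_zero]; exact mul_ne_zero h0 h0⟩

/-- **The five theta-free fields of `BallFacts` hold for the one-point datum** (continuity of the action and of
`J`, invertibility of `J`, transitivity, density of `Δ`, and `irred`). -/
theorem pointBallData_printFacts :
    ContinuousSMul (pointBallData U V c).Gr (pointBallData U V c).Pt ∧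
      (∀ x : (pointBallData U V c).Pt, Continuous fun g : (pointBallData U V c).Gr => (pointBallData U V c).J g x) ∧
      (∀ (g : (pointBallData U V c).Gr) (x : (pointBallData U V c).Pt), IsUnit ((pointBallData U V c).J g x)) ∧
      (∀ x y : (pointBallData U V c).Pt, ∃ g : (pointBallData U V c).Gr, g • x = y) ∧
      Dense (pointBallData U V c).Δ ∧
      (∀ (x : (pointBallData U V c).Pt) (v : Fin 2 → ℂ), v ≠ 0 →
        ∃ k : (pointBallData U V c).Gr, k • x = x ∧ wedge2 ((pointBallData U V c).J k x *ᵥ v) v ≠ 0) := by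
  refine ⟨⟨continuous_snd⟩, fun x => Units.continuous_val, fun g x => Units.isUnit g, fun x y => ⟨1, rfl⟩,
    dense_univ, fun x v hv => ?_⟩
  obtain ⟨g, hg⟩ := exists_gl_wedge2_mulVec_ne_zero v hv
  exact ⟨g, rfl, hg⟩

end Point

/-! ## § 2. Trivial theta sets: the five theta fields are free -/

section Trivial

variable {U}
variable (T : U.ThetaModel) {L : CMField} {ι₁ : L →+* ℂ} (V : HermSpace3 L ι₁) (c : SeesawCtx L)

/-- **With trivial theta sets `BallFacts` is exactly its five print fields**: for ANY ball datum whose class lift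
vanishes on the zero class, `T.Theta V c i Γ = {0}` (all `i, Γ`) makes `contEv transl evNe wedgeDict saturate`
hold outright. -/
theorem ballFacts_of_theta_trivial (b : U.BallData V c)
    (hΘ : ∀ (i : Fin 4) (Γ : Level V), T.Theta V c i Γ = {0})
    (hev : ∀ Γ : Level V, b.ev Γ 0 = 0)
    (csmul : ContinuousSMul b.Gr b.Pt) (contJ : ∀ x : b.Pt, Continuous fun g : b.Gr => b.J g x)
    (unitJ : ∀ (g : b.Gr) (x : b.Pt), IsUnit (b.J g x)) (trans : ∀ x y : b.Pt, ∃ g : b.Gr, g • x = y)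
    (dense : Dense b.Δ)
    (irred : ∀ (x : b.Pt) (v : Fin 2 → ℂ), v ≠ 0 → ∃ k : b.Gr, k • x = x ∧ wedge2 (b.J k x *ᵥ v) v ≠ 0) :
    T.BallFacts V c b where
  csmul := csmul
  contJ := contJ
  unitJ := unitJ
  trans := trans
  dense := dense
  irred := irred
  contEv i Γ ω hω := by
    rw [hΘ, mem_singleton_iff] at hω
    rw [hω, hev]
    exact continuous_const
  transl γ _ i Γ ω hω := by
    rw [hΘ, mem_singleton_iff] at hω
    refine ⟨Γ, 0, by rw [hΘ]; exact mem_singleton 0, ?_⟩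
    funext x
    rw [hω, hev]
    simp
  evNe i Γ ω hω h0 := by
    rw [hΘ, mem_singleton_iff] at hω
    exact absurd hω h0
  wedgeDict Γ ω₁ ω₂ hω₁ _ _ x := by
    rw [hΘ, mem_singleton_iff] at hω₁
    rw [hω₁, hev]
    simp [wedge2]
  saturate i Γ Γ' h ω hω := by
    rw [hΘ, mem_singleton_iff] at hω
    subst hω
    rw [map_zero, hΘ, hev, hev]
    exact ⟨mem_singleton 0, rfl⟩

/-- **A one-point ball passes `BallFacts` whenever the theta sets of the context are trivial.** -/
theorem ballFacts_pointBallData (hΘ : ∀ (i : Fin 4) (Γ : Level V), T.Theta V c i Γ = {0}) :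
    T.BallFacts V c (pointBallData U V c) := by
  obtain ⟨h₁, h₂, h₃, h₄, h₅, h₆⟩ := pointBallData_printFacts U V c
  exact ballFacts_of_theta_trivial T V c _ hΘ (fun _ => rfl) h₁ h₂ h₃ h₄ h₅ h₆

/-- … hence `T.BallInputs` (every good context) holds for the one-point data over a theta model with trivial
theta sets everywhere — good or not, the context plays no role. -/
theorem ballInputs_pointBallData
    (hΘ : ∀ {L : CMField} {ι₁ : L →+* ℂ} (V : HermSpace3 L ι₁) (c : SeesawCtx L) (i : Fin 4) (Γ : Level V),
      T.Theta V c i Γ = {0}) :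
    T.BallInputs (fun V c => pointBallData U V c) :=
  fun V c _ => ballFacts_pointBallData T V c (hΘ V c)

end Trivial

/-! ## § 3. Trivial theta sets starve the A6 engine -/

section Starved

variable {U}
variable (T : U.ThetaModel) {L : CMField} {ι₁ : L →+* ℂ} (V : HermSpace3 L ι₁) (c : SeesawCtx L)

/-- **`Open_supply` fails at a good context with trivial theta sets.** -/
theorem not_open_supply_of_theta_trivial (hc : T.GoodCtx ι₁ c)
    (hΘ : ∀ (i : Fin 4) (Γ : Level V), T.Theta V c i Γ ⊆ {0}) : ¬ T.Open_supply := by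
  intro hS
  obtain ⟨⟨Γ, ω, hω, h0⟩, -⟩ := hS V c hc
  exact h0 (hΘ 0 Γ hω)

/-- **`Open_thetaWedge` (A6 = PerL Prop. 4.3) fails at a good context with trivial theta sets** — so the ball
route `thetaWedge_of_ball` is starved there, whatever the ball data. -/
theorem not_open_thetaWedge_of_theta_trivial (hc : T.GoodCtx ι₁ c)
    (hΘ : ∀ (i : Fin 4) (Γ : Level V), T.Theta V c i Γ ⊆ {0}) : ¬ T.Open_thetaWedge := by
  intro hW
  obtain ⟨Γ, ω₁, hω₁, ω₂, -, hne⟩ := hW V c hc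
  apply hne
  rw [mem_singleton_iff.1 (hΘ 0 Γ hω₁), map_zero, LinearMap.zero_apply]

/-- The hypothesis `hs` of `exists_cup_ne_zero_of_ballFacts` is false in this regime (so the theorem is vacuous
there, for every ball datum and every `BallFacts` witness). -/
theorem not_supplyAt_of_theta_trivial (hΘ : ∀ (i : Fin 4) (Γ : Level V), T.Theta V c i Γ ⊆ {0}) :
    ¬ ((∃ Γ : Level V, ∃ ω ∈ T.Theta V c 0 Γ, ω ≠ 0) ∧ (∃ Γ : Level V, ∃ ω ∈ T.Theta V c 1 Γ, ω ≠ 0)) := by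
  rintro ⟨⟨Γ, ω, hω, h0⟩, -⟩
  exact h0 (hΘ 0 Γ hω)

end Starved

/-! ## § 4. Full theta sets: `BallFacts` constrains all of `H¹` -/

section Top

variable {U}
variable (T : U.ThetaModel) {L : CMField} {ι₁ : L →+* ℂ} (V : HermSpace3 L ι₁) (c : SeesawCtx L)
  (b : U.BallData V c)

/-- If `Θ_i(Γ) = univ` then `BallFacts` makes `ev Γ` detect EVERY nonzero degree-one class (not only the
`(1,0)`-classes). -/
theorem ev_ne_zero_of_ballFacts_top (hb : T.BallFacts V c b) {i : Fin 4} {Γ : Level V}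
    (hΘ : T.Theta V c i Γ = univ) (ω : U.CohC (U.pms L ι₁ V Γ) 1) (h0 : ω ≠ 0) : b.ev Γ ω ≠ 0 :=
  hb.evNe i Γ ω (by rw [hΘ]; exact mem_univ ω) h0

/-- If `Θ_i(Γ) = univ` then `BallFacts` makes every class lift continuous. -/
theorem continuous_ev_of_ballFacts_top (hb : T.BallFacts V c b) {i : Fin 4} {Γ : Level V}
    (hΘ : T.Theta V c i Γ = univ) (ω : U.CohC (U.pms L ι₁ V Γ) 1) : Continuous (b.ev Γ ω) :=
  hb.contEv i Γ ω (by rw [hΘ]; exact mem_univ ω)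

/-- If `Θ_0(Γ) = Θ_1(Γ) = univ` then `BallFacts` turns EVERY vanishing cup product in `H¹ ⊗ H¹ → H²` into a
pointwise vanishing wedge of lifts. -/
theorem wedge2_ev_eq_zero_of_ballFacts_top (hb : T.BallFacts V c b) {Γ : Level V}
    (hΘ₀ : T.Theta V c 0 Γ = univ) (hΘ₁ : T.Theta V c 1 Γ = univ) (ω₁ ω₂ : U.CohC (U.pms L ι₁ V Γ) 1)
    (hcup : U.cup2C (U.pms L ι₁ V Γ) 1 ω₁ ω₂ = 0) (x : b.Pt) : wedge2 (b.ev Γ ω₁ x) (b.ev Γ ω₂ x) = 0 :=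
  hb.wedgeDict Γ ω₁ ω₂ (by rw [hΘ₀]; exact mem_univ _) (by rw [hΘ₁]; exact mem_univ _) hcup x

/-- With `ev := 0` (e.g. the one-point datum) and some `Θ_i(Γ)` containing a nonzero class, `BallFacts` FAILS
(`evNe`): the record does see the difference between the two degenerate theta inputs. -/
theorem not_ballFacts_pointBallData_of_ne_zero_mem {i : Fin 4} {Γ : Level V} {ω : U.CohC (U.pms L ι₁ V Γ) 1}
    (hω : ω ∈ T.Theta V c i Γ) (h0 : ω ≠ 0) : ¬ T.BallFacts V c (pointBallData U V c) :=
  fun hb => hb.evNe i Γ ω hω h0 rfl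

end Top

end Sanity
end Model
end HodgeCM

end
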